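import Summits.ValiantsHypothesis.ValiantsHypothesis.Theorems.KPlusLogSqLawTropicalBTwoRowSharp

/-!
# Route «KPlusLogSqLaw», crux `TropicalB` (stmt-ValiantsHypothesis-19771) — the `m = 3` tropical row, rank-profile ceiling:
# `T(3, K) ≤ 18K − 53` for every `K ≥ 4`

HONEST FRAMING.  Helper file for the registered stubs of crux `TropicalB` (cell `pub-symmetroid`, seat val-sym-trop-p4 (g3), 2026-08-26).
A SMALL-FORMAT row (size `m = 3`, every `K`) far inside the crux's known regime — nothing on `TropicalB` in its window,
`WeakLifting`, `MatrixDescartes` (stmt-ValiantsHypothesis-18050) or VP ≠ VNP.  It evaluates the RANK-PROFILE law of this lane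
(`tropRootLawAt_rankProfile`, Theorems/KPlusLogSqLawTropicalBRankProfile.lean, val-sym-trop-p4 (g2): a sign-alternating dominant chain of
format `(m, K)` has at most `∑_r min(m!, π_{m,K}(r))` terms) at `m = 3` in closed form, where it had been left «not evaluated in the kernel»:

* `tropRootLawAt_three_sharp : 4 ≤ K → TropRootLawAt 3 K (18 * K - 53)`.

Against the tree: the thin law `TropicalCensus.tropRootLawAt_thin` gives `3!·(3(K−1)+1) − 1 = 18K − 13`, slope counting
`TropicalCensus.tropRootLawAt_choose` gives `C(K+2,3) − 1`; the new row is below both from `K = 7` on (`73 < 83`), ties counting at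
`K = 4` (`19`, where it is SHARP: `T(3,4) = 19`, `TropicalCensus.census_three_four`, p431254) and at `K = 6` (`55`), and is implied by
counting at `K = 5` (`34 < 37`).  Lower side of record for the row: `T(3,K) ≥ 6K − 11` (two entry-disjoint parabola families, seat memo
REGIME-COLLAPSE-g2.md §3, not in the kernel); whether `18K − 53` is attained for large `K` is OPEN.

PROOF (the thin law's injection `k ↦ (σ_k, termRank)`, minus the twelve extreme total ranks).  Chain terms with the same permutation have
strictly increasing total rank (`TropicalCensus.d_lt_of_dominant`), so at most `3! = 6` chain terms share a total rank `r`.  Chain terms with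
the same MULTISET of column ranks have the same slope (the rank `dRank` is injective on exponent values, `d_eq_of_dRank_eq`), hence coincide
(`TropicalCensus.slope_lt_of_dominant`); a multiset of three ranks with total `r ≤ 5` is one of `p(0)+…+p(5) = 1+1+2+3+4+5 = 16` multisets
(partitions into at most three parts), and symmetrically for the deficiencies `K−1−rank` at total rank `≥ 3(K−1) − 5`.  Hence for `K ≥ 5`
(the two extreme zones are disjoint) `n + 1 ≤ 16 + 6·(3K − 14) + 16 = 18K − 52`; at `K = 4` the bound `19` is slope counting.
[folklore] counting; the statement is the cell's (no citation exists).
-/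

set_option linter.dupNamespace false
set_option autoImplicit false

namespace Summit.ValiantsHypothesis.ValiantsHypothesis.Theorems.KPlusLogSqLaw

open Summit.ValiantsHypothesis.ValiantsHypothesis.Theorems.MatrixDescartes.Negative
open Summit.ValiantsHypothesis.ValiantsHypothesis.Theorems.LacunarySymmetroidMatrixDescartes
open Summit.ValiantsHypothesis.ValiantsHypothesis.Theorems.LacunarySymmetroidMatrixDescartes.TropicalCensus
open Finset

variable {K : ℕ}

/-- total rank of a `3 × 3` term = the three column ranks. -/
theorem termRank_three (d : Fin K → ℕ) (q : Equiv.Perm (Fin 3) × (Fin 3 → Fin K)) :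
    termRank d q = dRank d (q.2 0) + dRank d (q.2 1) + dRank d (q.2 2) := by
  unfold termRank; rw [Fin.sum_univ_three]

/-- slope of a `3 × 3` term = the three column exponents. -/
theorem slope_three (d : Fin K → ℕ) (q : Equiv.Perm (Fin 3) × (Fin 3 → Fin K)) :
    TropicalCensus.slope d q = (d (q.2 0) : ℤ) + d (q.2 1) + d (q.2 2) := by
  unfold TropicalCensus.slope; rw [Fin.sum_univ_three]

/-- The sixteen multisets of three naturals with total at most five (the partitions of `0, …, 5` into at most three parts),
as a decision over `Fin 6`. [folklore] -/
theorem mem_sixteen_fin : ∀ a b c : Fin 6, (a : ℕ) + b + c ≤ 5 →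
    ({(a : ℕ), (b : ℕ), (c : ℕ)} : Multiset ℕ) ∈
      ({ {0, 0, 0}, {0, 0, 1}, {0, 0, 2}, {0, 1, 1}, {0, 0, 3}, {0, 1, 2}, {1, 1, 1}, {0, 0, 4}, {0, 1, 3}, {0, 2, 2},
         {1, 1, 2}, {0, 0, 5}, {0, 1, 4}, {0, 2, 3}, {1, 1, 3}, {1, 2, 2} } : Finset (Multiset ℕ)) := by
  decide

/-- Every multiset of three naturals with total at most five is one of sixteen. [folklore] -/
theorem mem_sixteen_of_sum_le_five (a b c : ℕ) (h : a + b + c ≤ 5) :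
    ({a, b, c} : Multiset ℕ) ∈
      ({ {0, 0, 0}, {0, 0, 1}, {0, 0, 2}, {0, 1, 1}, {0, 0, 3}, {0, 1, 2}, {1, 1, 1}, {0, 0, 4}, {0, 1, 3}, {0, 2, 2},
         {1, 1, 2}, {0, 0, 5}, {0, 1, 4}, {0, 2, 3}, {1, 1, 3}, {1, 2, 2} } : Finset (Multiset ℕ)) := by
  have := mem_sixteen_fin ⟨a, by omega⟩ ⟨b, by omega⟩ ⟨c, by omega⟩ h
  simpa using this

/-- The list of sixteen has sixteen members. [folklore] -/
theorem card_sixteen :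
    (({ {0, 0, 0}, {0, 0, 1}, {0, 0, 2}, {0, 1, 1}, {0, 0, 3}, {0, 1, 2}, {1, 1, 1}, {0, 0, 4}, {0, 1, 3}, {0, 2, 2},
         {1, 1, 2}, {0, 0, 5}, {0, 1, 4}, {0, 2, 3}, {1, 1, 3}, {1, 2, 2} } : Finset (Multiset ℕ))).card = 16 := by
  decide

/-- **The `m = 3` tropical row, rank-profile ceiling: `T(3, K) ≤ 18K − 53` for every `K ≥ 4`.**
Sharp at `K = 4` (`T(3,4) = 19`, `TropicalCensus.census_three_four`); equal to slope counting at `K = 4, 6`, weaker at `K = 5`,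
stronger from `K = 7` on. [folklore] counting, via the rank-profile law of `…TropicalBRankProfile` evaluated at `m = 3` -/
theorem tropRootLawAt_three_sharp (K : ℕ) (hK : 4 ≤ K) : TropRootLawAt 3 K (18 * K - 53) := by
  classical
  rcases (show K = 4 ∨ 5 ≤ K by omega) with rfl | hK5
  · -- `K = 4`: slope counting, `C(6,3) − 1 = 19 = 18·4 − 53`
    exact tropRootLawAt_mono (by decide) (tropRootLawAt_choose 3 4)
  intro d v ε n θ p hε hθ hdom halt
  have hinj : Function.Injective p := stub_dominantInjective 3 K d v ε n θ p hθ hdom halt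
  -- (1) same permutation ⇒ total rank strictly increases (as in `tropRootLawAt_thin` / `tropRootLawAt_two_sharp`)
  have hkey : ∀ a b : Fin (n + 1), a < b → (p a).1 = (p b).1 → termRank d (p a) < termRank d (p b) := by
    intro a b hab h1
    have hne : p a ≠ p b := fun h => (ne_of_lt hab) (hinj h)
    have h2 : (p a).2 ≠ (p b).2 := fun h => hne (Prod.ext h1 h)
    obtain ⟨i, hi⟩ := Function.ne_iff.mp h2
    have hpa : p a = ((p a).1, (p a).2) := rfl
    have hpb : p b = ((p a).1, (p b).2) := by rw [h1]
    have hda : IsDominant d v ε (θ a) ((p a).1, (p a).2) := hpa ▸ hdom a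
    have hdb : IsDominant d v ε (θ b) ((p a).1, (p b).2) := hpb ▸ hdom b
    have hmono : ∀ j, dRank d ((p a).2 j) ≤ dRank d ((p b).2 j) := by
      intro j
      by_cases hj : (p a).2 j = (p b).2 j
      · rw [hj]
      · exact (dRank_lt_of_lt d (d_lt_of_dominant d v ε (hθ hab) _ _ _ hda hdb j hj)).le
    have hstrict : dRank d ((p a).2 i) < dRank d ((p b).2 i) :=
      dRank_lt_of_lt d (d_lt_of_dominant d v ε (hθ hab) _ _ _ hda hdb i hi)
    unfold termRank
    exact sum_lt_sum (fun j _ => hmono j) ⟨i, mem_univ _, hstrict⟩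
  have hsame : ∀ a b : Fin (n + 1), (p a).1 = (p b).1 → termRank d (p a) = termRank d (p b) → a = b := by
    intro a b h1 h2
    rcases lt_trichotomy a b with h | h | h
    · exact absurd h2 (ne_of_lt (hkey a b h h1))
    · exact h
    · exact absurd h2.symm (ne_of_lt (hkey b a h h1.symm))
  -- (2) equal slopes ⇒ equal indices
  have hslope : ∀ a b : Fin (n + 1), TropicalCensus.slope d (p a) = TropicalCensus.slope d (p b) → a = b := by
    intro a b hs
    rcases lt_trichotomy a b with h | h | h
    · exact absurd hs (ne_of_lt (slope_lt_of_dominant d v ε (hθ h) (fun e => (ne_of_lt h) (hinj e)) (hdom a) (hdom b)))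
    · exact h
    · exact absurd hs.symm
        (ne_of_lt (slope_lt_of_dominant d v ε (hθ h) (fun e => (ne_of_lt h) (hinj e)) (hdom b) (hdom a)))
  -- (3) exponent values as a function of ranks
  let g : ℕ → ℕ := fun r => if h : ∃ l : Fin K, dRank d l = r then d h.choose else 0
  have hg : ∀ l, g (dRank d l) = d l := by
    intro l
    have hex : ∃ l' : Fin K, dRank d l' = dRank d l := ⟨l, rfl⟩
    simp only [g, dif_pos hex]
    exact d_eq_of_dRank_eq d hex.choose_spec
  -- the rank profile of a chain term (multiset of the three column ranks) and the deficiency profile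
  let key : Fin (n + 1) → Multiset ℕ := fun k =>
    {dRank d ((p k).2 0), dRank d ((p k).2 1), dRank d ((p k).2 2)}
  let key' : Fin (n + 1) → Multiset ℕ := fun k =>
    {K - 1 - dRank d ((p k).2 0), K - 1 - dRank d ((p k).2 1), K - 1 - dRank d ((p k).2 2)}
  have hkey_slope : ∀ k, TropicalCensus.slope d (p k) = ((key k).map fun r => (g r : ℤ)).sum := by
    intro k
    rw [slope_three]
    simp only [key, Multiset.insert_eq_cons, Multiset.map_cons, Multiset.map_singleton, Multiset.sum_cons,
      Multiset.sum_singleton, hg]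
    ring
  have hkey_inj : ∀ a b : Fin (n + 1), key a = key b → a = b := by
    intro a b h
    apply hslope
    rw [hkey_slope, hkey_slope, h]
  have hkk : ∀ k, key k = (key' k).map fun e => K - 1 - e := by
    intro k
    have h0 := dRank_le d ((p k).2 0)
    have h1 := dRank_le d ((p k).2 1)
    have h2 := dRank_le d ((p k).2 2)
    simp only [key, key', Multiset.insert_eq_cons, Multiset.map_cons, Multiset.map_singleton]
    rw [Nat.sub_sub_self h0, Nat.sub_sub_self h1, Nat.sub_sub_self h2]
  have hkey'_inj : ∀ a b : Fin (n + 1), key' a = key' b → a = b := by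
    intro a b h
    apply hkey_inj
    rw [hkk, hkk, h]
  -- (4) the three zones of total rank
  set S16 : Finset (Multiset ℕ) :=
    ({ {0, 0, 0}, {0, 0, 1}, {0, 0, 2}, {0, 1, 1}, {0, 0, 3}, {0, 1, 2}, {1, 1, 1}, {0, 0, 4}, {0, 1, 3}, {0, 2, 2},
       {1, 1, 2}, {0, 0, 5}, {0, 1, 4}, {0, 2, 3}, {1, 1, 3}, {1, 2, 2} } : Finset (Multiset ℕ)) with hS16
  have hS16card : S16.card = 16 := by rw [hS16]; exact card_sixteen
  set LOW := (univ : Finset (Fin (n + 1))).filter fun k => termRank d (p k) ≤ 5 with hLOW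
  set NLOW := (univ : Finset (Fin (n + 1))).filter fun k => ¬ termRank d (p k) ≤ 5 with hNLOW
  set HIGH := NLOW.filter fun k => 3 * K - 8 ≤ termRank d (p k) with hHIGH
  set MID := NLOW.filter fun k => ¬ 3 * K - 8 ≤ termRank d (p k) with hMID
  have hsplit1 : LOW.card + NLOW.card = n + 1 := by
    rw [hLOW, hNLOW, card_filter_add_card_filter_not, card_univ, Fintype.card_fin]
  have hsplit2 : HIGH.card + MID.card = NLOW.card := by
    rw [hHIGH, hMID, card_filter_add_card_filter_not]
  -- LOW ≤ 16 : rank profiles of total ≤ 5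
  have hLOWle : LOW.card ≤ 16 := by
    rw [← hS16card]
    refine card_le_card_of_injOn key ?_ ?_
    · intro k hk
      rw [mem_coe, hLOW, mem_filter] at hk
      rw [mem_coe, hS16]
      have hr := hk.2
      rw [termRank_three] at hr
      exact mem_sixteen_of_sum_le_five _ _ _ hr
    · intro a _ b _ hab
      exact hkey_inj a b hab
  -- HIGH ≤ 16 : deficiency profiles of total ≤ 5
  have hHIGHle : HIGH.card ≤ 16 := by
    rw [← hS16card]
    refine card_le_card_of_injOn key' ?_ ?_
    · intro k hk
      rw [mem_coe, hHIGH, mem_filter] at hk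
      rw [mem_coe, hS16]
      have hr := hk.2
      rw [termRank_three] at hr
      have h0 := dRank_le d ((p k).2 0)
      have h1 := dRank_le d ((p k).2 1)
      have h2 := dRank_le d ((p k).2 2)
      exact mem_sixteen_of_sum_le_five _ _ _ (by omega)
    · intro a _ b _ hab
      exact hkey'_inj a b hab
  -- MID ≤ 6·(3K − 14) : (permutation, total rank) with total rank in [6, 3K − 8)
  have hMIDle : MID.card ≤ 6 * (3 * K - 14) := by
    have hc : ((univ : Finset (Equiv.Perm (Fin 3))) ×ˢ (Finset.Ico 6 (3 * K - 8))).card = 6 * (3 * K - 14) := by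
      rw [card_product, card_univ, Fintype.card_perm, Fintype.card_fin, Nat.card_Ico]
      norm_num
      omega
    rw [← hc]
    refine card_le_card_of_injOn (fun k => ((p k).1, termRank d (p k))) ?_ ?_
    · intro k hk
      rw [mem_coe, hMID, mem_filter, hNLOW, mem_filter] at hk
      simp only [mem_coe, mem_product, mem_Ico, mem_univ, true_and]
      constructor <;> omega
    · intro a _ b _ hab
      simp only [Prod.mk.injEq] at hab
      exact hsame a b hab.1 hab.2
  -- (5) total
  have htot : n + 1 ≤ 16 + 16 + 6 * (3 * K - 14) := by
    calc n + 1 = LOW.card + (HIGH.card + MID.card) := by rw [hsplit2, hsplit1]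
      _ ≤ 16 + (16 + 6 * (3 * K - 14)) := Nat.add_le_add hLOWle (Nat.add_le_add hHIGHle hMIDle)
      _ = 16 + 16 + 6 * (3 * K - 14) := by ring
  show n ≤ 18 * K - 53
  omega

/-- The `m = 3` row against the two census laws it refines, for the record: it is below the thin law `18K − 13` always and
below slope counting `C(K+2, 3) − 1` exactly when `K ≥ 7` (numerical remark; here only the instance `K = 7`: `73 < 83`). -/
theorem three_sharp_lt_choose_seven : 18 * 7 - 53 < (7 + 3 - 1).choose 3 - 1 := by decide

end Summit.ValiantsHypothesis.ValiantsHypothesis.Theorems.KPlusLogSqLaw
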